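import Summits.CriticalPhenomena.PercolationContinuityZ3.Theorems.Transplant.SkelPhiFaceRouteReadings
import Summits.CriticalPhenomena.PercolationContinuityZ3.Theorems.Transplant.KNParaRootBridge
import HarnessLib

/-!
# N1 ({±1} node), (F) inner route, part R5a′ (hp-8 g33): **THE PER-CENTRE NUMBERS OF A FACE ROUTE, PER-REGION READINGS** — the data and integer facts of
# `faceRoute_of_numbers4_x/_y` that depend on the kit centre `c` (run origins `c_L, c_T` and their offsets `y_L, y_T`, stride counts `N_r, N₃`,
# tangential sign `σ_T`, footprint boxes and their conversions, the prism / last-core boxes and their fine readings, the two numeric cross links,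
# clearances, reaches), bundled as ONE structure `FaceRunNums` so that the (F) kit clause can ask for `∀ c, … → Nonempty (FaceRunNums …)` and the
# arithmetic that produces them from the contact's cell (part R5b) is a separate file.  x-faces read the structure with `(along, tangential) =
# (xRunSched in runX φ c_L σ, yRunSched in runY φ c_T σ_T)`, y′-faces with the roles exchanged — the field list is the same (the schedules enter only
# through the boxes `hprism/hprismY/hlastc` and the cross link `hxy`, stated for both readings by the flag-free pair of fields `hxyX/hxyY` below).
builds on p205010 (kernel theorem, internal audit signed; external expert review pending) — nothing in this file uses p205010; no claim about the open node.
Lane `prim-bschramm`, seat `prim-hp-8` (gen 33); helper file (`--supports stmt-CriticalPhenomena-4575 --as helper`).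
* **`Skelφ.FaceRunNums2`** (structure; k-indexed = per-region readings of both runs, superseding `FaceRunNums`).
[cite: KozmaNitzan2024, §4 Lemma 11 (pp. 22–23), Lemma 12 (pp. 23–25)] [cite: MartineauTassion2017, §4.3 Lemma 4.2]
-/

noncomputable section

open scoped Classical

namespace Summit.CriticalPhenomena.PercolationContinuityZ3.Theorems.Transplant

namespace Skelφ

open Literature.Probability.Percolation Literature.Probability.LatticeModels SimpleGraph KNCells
open Literature.Probability.Percolation.KozmaNitzan.Cells (oth sgOf)
open KNLevels ChainPlanar ChainPara
open Literature.Barriers.CriticalPhenomena (graphBall)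
open TwoAxis.Para (modulus)

variable {V : Type} [DecidableEq V]

/-- **THE PER-CENTRE NUMBERS OF A FACE ROUTE** at the kit centre `c` (see the module docstring). `isX = true`: along x-run / tangential y′-run
(x-faces); `isX = false`: along y′-run / tangential x-run (y′-faces). [cite: KozmaNitzan2024, §4 Lemma 11 (pp. 22–23), Lemma 12 (pp. 23–25)] -/
structure FaceRunNums2 (G : SimpleGraph V) [G.LocallyFinite] (φ ψc : V → Site 2) (isX : Bool) (c : V) (Af : ℤ) (nL : ℕ) (hL vα vβ c0f c1f Df : ℤ)
    (du : MDir) (σ : ℤ) (B : BridgePrm) (ℓ' R's qB R'₃ qB₃ : ℕ) (vL : ℤ) (hnL : 1 ≤ nL) (hvL : |vL| ≤ nL)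
    (hlay : (nL + hL.natAbs : ℕ) ≤ (nL : ℤ) * ℓ' + 1) (kb : ℕ) (Pl : Finset (Site 2)) (MM Zc : Finset V) (L : ℕ) (kpar kperp : ℤ) where
  /-- along origin -/
  cL : V
  /-- tangential origin -/
  cT : V
  /-- `φ cL = φ c + yL` -/
  yL : Site 2
  /-- `φ cT = φ c + yT` -/
  yT : Site 2
  /-- reach of `cL` -/
  RcL : ℕ
  /-- reach of `cT` -/
  RcT : ℕ
  /-- along stride count -/
  Nr : ℕ
  /-- tangential stride count -/
  N₃ : ℕ
  /-- tangential sign -/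
  σT : ℤ
  /-- habitat footprint box -/
  flo : ℤ
  /-- habitat footprint box -/
  fhi : ℤ
  /-- habitat footprint box -/
  fw : ℤ
  /-- target footprint box -/
  glo : ℤ
  /-- target footprint box -/
  ghi : ℤ
  /-- target footprint box -/
  gw : ℤ
  /-- along prism box -/
  paLo : ℕ → ℤ
  /-- along prism box -/
  pbLo : ℕ → ℤ
  /-- along prism box -/
  paHi : ℕ → ℤ
  /-- along prism box -/
  pbHi : ℕ → ℤ
  /-- along prism fine reading -/
  PLO : ℕ → Site 2
  /-- along prism fine reading -/
  PHI : ℕ → Site 2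
  /-- tangential prism box -/
  yaLo : ℕ → ℤ
  /-- tangential prism box -/
  ybLo : ℕ → ℤ
  /-- tangential prism box -/
  yaHi : ℕ → ℤ
  /-- tangential prism box -/
  ybHi : ℕ → ℤ
  /-- last core box -/
  laLo : ℤ
  /-- last core box -/
  lbLo : ℤ
  /-- last core box -/
  laHi : ℤ
  /-- last core box -/
  lbHi : ℤ
  /-- tangential prism fine reading -/
  YLO : ℕ → Site 2
  /-- tangential prism fine reading -/
  YHI : ℕ → Site 2
  /-- last core fine reading -/
  LLO : Site 2
  /-- last core fine reading -/
  LHI : Site 2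
  hcLφ : φ cL = φ c + yL
  hcTφ : φ cT = φ c + yT
  hcLπ : cL ∈ graphBall G c RcL
  hcTπ : cT ∈ graphBall G c RcT
  hσT : σT = 1 ∨ σT = -1
  hPlfoot : ∀ w ∈ graphBall G c L, FootBox flo fhi fw du (fineSkel φ c Af nL hL vα vβ c0f c1f (Df / 2) (Df / 2) Df w) → ψc w ∈ Pl
  hMfoot : ∀ w ∈ graphBall G c L, FootBox glo ghi gw du (fineSkel φ c Af nL hL vα vβ c0f c1f (Df / 2) (Df / 2) Df w) → w ∈ MM
  hMZ : Disjoint MM Zc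
  hfR : flo ≤ -kpar ∧ kpar ≤ fhi ∧ kperp ≤ fw
  hreg : ∀ k ≤ Nr, (if isX then (xRunSched nL ℓ' hL R's qB Nr).region k else (yRunSched hnL hvL hlay R's qB Nr).region k) ⊆
    Finset.Icc (pt (paLo k) (pbLo k)) (pt (paHi k) (pbHi k))
  hregY : ∀ k ≤ N₃, (if isX then (yRunSched hnL hvL hlay R'₃ qB₃ N₃).region k else (xRunSched nL ℓ' hL R'₃ qB₃ N₃).region k) ⊆
    Finset.Icc (pt (yaLo k) (ybLo k)) (pt (yaHi k) (ybHi k))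
  hlastc : (if isX then (yRunSched hnL hvL hlay R'₃ qB₃ N₃).core (N₃ + 1) else (xRunSched nL ℓ' hL R'₃ qB₃ N₃).core (N₃ + 1)) ⊆
    Finset.Icc (pt laLo lbLo) (pt laHi lbHi)
  /-- along prism reading, axis 0 low (`(qa, qb)` = (along, transverse) boxes in the x-frame `σ = 1` after sign unification: x-run `(pa, pb)`,
  y′-run `(pb, pa)`) -/
  hP0 : ∀ k ≤ Nr, PLO k 0 ≤ TwoAxis.Para.coarse c0f (Df / 2) Df (TwoAxis.Para.lam0 Af vα vβ yL) +
    (c0f * (Af * (modulus nL hL vα vβ * (min (σ * (if isX then paLo k else pbLo k)) (σ * (if isX then paHi k else pbHi k))) -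
      max (vα * ((shearUnit nL hL : ℤ) * (min (σ * (if isX then pbLo k else paLo k)) (σ * (if isX then pbHi k else paHi k)) - 1)))
        (vα * ((shearUnit nL hL : ℤ) * (max (σ * (if isX then pbLo k else paLo k)) (σ * (if isX then pbHi k else paHi k))) + shearUnit nL hL - 1))) / nL)) / Df
  hP1 : ∀ k ≤ Nr, TwoAxis.Para.coarse c0f (Df / 2) Df (TwoAxis.Para.lam0 Af vα vβ yL) +
    (c0f * (Af * (modulus nL hL vα vβ * (max (σ * (if isX then paLo k else pbLo k)) (σ * (if isX then paHi k else pbHi k))) -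
      min (vα * ((shearUnit nL hL : ℤ) * (min (σ * (if isX then pbLo k else paLo k)) (σ * (if isX then pbHi k else paHi k)) - 1)))
        (vα * ((shearUnit nL hL : ℤ) * (max (σ * (if isX then pbLo k else paLo k)) (σ * (if isX then pbHi k else paHi k))) + shearUnit nL hL - 1))) / nL)) / Df
      + 1 ≤ PHI k 0
  hP2 : ∀ k ≤ Nr, PLO k 1 ≤ TwoAxis.Para.coarse c1f (Df / 2) Df (TwoAxis.Para.lam1 Af nL hL yL) +
    (c1f * (Af * ((shearUnit nL hL : ℤ) * (min (σ * (if isX then pbLo k else paLo k)) (σ * (if isX then pbHi k else paHi k)) - 1)))) / Df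
  hP3 : ∀ k ≤ Nr, TwoAxis.Para.coarse c1f (Df / 2) Df (TwoAxis.Para.lam1 Af nL hL yL) +
    (c1f * (Af * ((shearUnit nL hL : ℤ) * (max (σ * (if isX then pbLo k else paLo k)) (σ * (if isX then pbHi k else paHi k))) + shearUnit nL hL - 1))) / Df + 1
      ≤ PHI k 1
  hPf₁ : ∀ k ≤ Nr, sgOf du = 1 → flo ≤ PLO k du.1 ∧ PHI k du.1 ≤ fhi
  hPf₂ : ∀ k ≤ Nr, sgOf du = -1 → flo ≤ -PHI k du.1 ∧ -PLO k du.1 ≤ fhi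
  hPf₃ : ∀ k ≤ Nr, -fw ≤ PLO k (oth du.1) ∧ PHI k (oth du.1) ≤ fw
  hY0 : ∀ k ≤ N₃, YLO k 0 ≤ TwoAxis.Para.coarse c0f (Df / 2) Df (TwoAxis.Para.lam0 Af vα vβ yT) +
    (c0f * (Af * (modulus nL hL vα vβ * (min (σT * (if isX then ybLo k else yaLo k)) (σT * (if isX then ybHi k else yaHi k))) -
      max (vα * ((shearUnit nL hL : ℤ) * (min (σT * (if isX then yaLo k else ybLo k)) (σT * (if isX then yaHi k else ybHi k)) - 1)))
        (vα * ((shearUnit nL hL : ℤ) * (max (σT * (if isX then yaLo k else ybLo k)) (σT * (if isX then yaHi k else ybHi k))) + shearUnit nL hL - 1))) / nL)) / Df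
  hY1 : ∀ k ≤ N₃, TwoAxis.Para.coarse c0f (Df / 2) Df (TwoAxis.Para.lam0 Af vα vβ yT) +
    (c0f * (Af * (modulus nL hL vα vβ * (max (σT * (if isX then ybLo k else yaLo k)) (σT * (if isX then ybHi k else yaHi k))) -
      min (vα * ((shearUnit nL hL : ℤ) * (min (σT * (if isX then yaLo k else ybLo k)) (σT * (if isX then yaHi k else ybHi k)) - 1)))
        (vα * ((shearUnit nL hL : ℤ) * (max (σT * (if isX then yaLo k else ybLo k)) (σT * (if isX then yaHi k else ybHi k))) + shearUnit nL hL - 1))) / nL)) / Df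
      + 1 ≤ YHI k 0
  hY2 : ∀ k ≤ N₃, YLO k 1 ≤ TwoAxis.Para.coarse c1f (Df / 2) Df (TwoAxis.Para.lam1 Af nL hL yT) +
    (c1f * (Af * ((shearUnit nL hL : ℤ) * (min (σT * (if isX then yaLo k else ybLo k)) (σT * (if isX then yaHi k else ybHi k)) - 1)))) / Df
  hY3 : ∀ k ≤ N₃, TwoAxis.Para.coarse c1f (Df / 2) Df (TwoAxis.Para.lam1 Af nL hL yT) +
    (c1f * (Af * ((shearUnit nL hL : ℤ) * (max (σT * (if isX then yaLo k else ybLo k)) (σT * (if isX then yaHi k else ybHi k))) + shearUnit nL hL - 1))) / Df + 1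
      ≤ YHI k 1
  hYf₁ : ∀ k ≤ N₃, sgOf du = 1 → flo ≤ YLO k du.1 ∧ YHI k du.1 ≤ fhi
  hYf₂ : ∀ k ≤ N₃, sgOf du = -1 → flo ≤ -YHI k du.1 ∧ -YLO k du.1 ≤ fhi
  hYf₃ : ∀ k ≤ N₃, -fw ≤ YLO k (oth du.1) ∧ YHI k (oth du.1) ≤ fw
  hL0 : LLO 0 ≤ TwoAxis.Para.coarse c0f (Df / 2) Df (TwoAxis.Para.lam0 Af vα vβ yT) +
    (c0f * (Af * (modulus nL hL vα vβ * (min (σT * (if isX then lbLo else laLo)) (σT * (if isX then lbHi else laHi))) -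
      max (vα * ((shearUnit nL hL : ℤ) * (min (σT * (if isX then laLo else lbLo)) (σT * (if isX then laHi else lbHi)) - 1)))
        (vα * ((shearUnit nL hL : ℤ) * (max (σT * (if isX then laLo else lbLo)) (σT * (if isX then laHi else lbHi))) + shearUnit nL hL - 1))) / nL)) / Df
  hL1 : TwoAxis.Para.coarse c0f (Df / 2) Df (TwoAxis.Para.lam0 Af vα vβ yT) +
    (c0f * (Af * (modulus nL hL vα vβ * (max (σT * (if isX then lbLo else laLo)) (σT * (if isX then lbHi else laHi))) -
      min (vα * ((shearUnit nL hL : ℤ) * (min (σT * (if isX then laLo else lbLo)) (σT * (if isX then laHi else lbHi)) - 1)))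
        (vα * ((shearUnit nL hL : ℤ) * (max (σT * (if isX then laLo else lbLo)) (σT * (if isX then laHi else lbHi))) + shearUnit nL hL - 1))) / nL)) / Df
      + 1 ≤ LHI 0
  hL2 : LLO 1 ≤ TwoAxis.Para.coarse c1f (Df / 2) Df (TwoAxis.Para.lam1 Af nL hL yT) +
    (c1f * (Af * ((shearUnit nL hL : ℤ) * (min (σT * (if isX then laLo else lbLo)) (σT * (if isX then laHi else lbHi)) - 1)))) / Df
  hL3 : TwoAxis.Para.coarse c1f (Df / 2) Df (TwoAxis.Para.lam1 Af nL hL yT) +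
    (c1f * (Af * ((shearUnit nL hL : ℤ) * (max (σT * (if isX then laLo else lbLo)) (σT * (if isX then laHi else lbHi))) + shearUnit nL hL - 1))) / Df + 1
      ≤ LHI 1
  hLg₁ : sgOf du = 1 → glo ≤ LLO du.1 ∧ LHI du.1 ≤ ghi
  hLg₂ : sgOf du = -1 → glo ≤ -LHI du.1 ∧ -LLO du.1 ≤ ghi
  hLg₃ : -gw ≤ LLO (oth du.1) ∧ LHI (oth du.1) ≤ gw
  /-- cross link bridge → along run: x-reading -/
  hxaX : isX = true → ∀ x ∈ Finset.Icc B.core1Lo B.core1Hi, |x 0 - σ * yL 0| ≤ qB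
  hxbX : isX = true → ∀ x ∈ Finset.Icc B.core1Lo B.core1Hi,
    |σ * ((nL : ℤ) * (x 1 - yL 1) - hL * (σ * x 0 - yL 0))| + shearUnit nL hL ≤ ((nL * ℓ' / shearUnit nL hL + 1 : ℕ) : ℤ) * shearUnit nL hL
  /-- cross link bridge → along run: y′-reading -/
  hxaY : isX = false → ∀ x ∈ Finset.Icc B.core1Lo B.core1Hi,
    -((((nL : ℤ) + vL).toNat : ℕ) : ℤ) ≤ x 0 - σ * yL 0 ∧ x 0 - σ * yL 0 ≤ ((((nL : ℤ) - vL).toNat : ℕ) : ℤ)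
  hxbY : isX = false → ∀ x ∈ Finset.Icc B.core1Lo B.core1Hi,
    |σ * ((nL : ℤ) * (x 1 - yL 1) - hL * (σ * x 0 - yL 0))| + shearUnit nL hL ≤ ((qB : ℤ) + 1) * shearUnit nL hL
  /-- cross link along → tangential: x-reading -/
  hxyX : isX = true → ∀ a s : ℤ, (xPrmW nL ℓ' hL R's qB Nr).aLo (Nr + 1) ≤ a → a ≤ (xPrmW nL ℓ' hL R's qB Nr).aHi (Nr + 1) →
    (xPrmW nL ℓ' hL R's qB Nr).bLo (Nr + 1) ≤ s / (shearUnit nL hL : ℤ) → s / (shearUnit nL hL : ℤ) ≤ (xPrmW nL ℓ' hL R's qB Nr).bHi (Nr + 1) →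
    (yPrmW nL ℓ' hL vL R'₃ qB₃ N₃).InCore 0 ((σT * σ * s - σT * ((nL : ℤ) * (yT - yL) 1 - hL * (yT - yL) 0)) / (shearUnit nL hL : ℤ))
      (σT * σ * a - σT * (yT - yL) 0)
  /-- cross link along → tangential: y′-reading -/
  hxyY : isX = false → ∀ a s : ℤ, (yPrmW nL ℓ' hL vL R's qB Nr).aLo (Nr + 1) ≤ s / (shearUnit nL hL : ℤ) →
    s / (shearUnit nL hL : ℤ) ≤ (yPrmW nL ℓ' hL vL R's qB Nr).aHi (Nr + 1) →
    (yPrmW nL ℓ' hL vL R's qB Nr).bLo (Nr + 1) ≤ a → a ≤ (yPrmW nL ℓ' hL vL R's qB Nr).bHi (Nr + 1) →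
    (xPrmW nL ℓ' hL R'₃ qB₃ N₃).InCore 0 (σT * σ * a - σT * (yT - yL) 0)
      ((σT * σ * s - σT * ((nL : ℤ) * (yT - yL) 1 - hL * (yT - yL) 0)) / (shearUnit nL hL : ℤ))
  hclr : ∀ k ≤ Nr, (kb : ℤ) < (if isX then paLo k else pbLo k) + σ * yL 0
  hclr₃ : ∀ k ≤ N₃, ∀ b : ℤ, min (σT * (if isX then ybLo k else yaLo k)) (σT * (if isX then ybHi k else yaHi k)) ≤ b →
    b ≤ max (σT * (if isX then ybLo k else yaLo k)) (σT * (if isX then ybHi k else yaHi k)) → (kb : ℤ) < σ * (b + yT 0)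
  hπ2X : isX = true → RcL + (Nr + 1) * shearUnit nL hL ≤ L
  hπ2Y : isX = false → ∀ k ≤ Nr, RcL + (((((k + 1 : ℕ) : ℤ) * vL).natAbs +
    (((shearUnit nL hL : ℤ) * |((k + 1 : ℕ) : ℤ) * (yPrmW nL ℓ' hL vL R's qB Nr).sLo| + |hL| * |((k + 1 : ℕ) : ℤ) * vL| + shearUnit nL hL) / nL).natAbs + 1))
      ≤ L
  hπ3X : isX = true → ∀ k ≤ N₃, RcT + (((((k + 1 : ℕ) : ℤ) * vL).natAbs +
    (((shearUnit nL hL : ℤ) * |((k + 1 : ℕ) : ℤ) * (yPrmW nL ℓ' hL vL R'₃ qB₃ N₃).sLo| + |hL| * |((k + 1 : ℕ) : ℤ) * vL| + shearUnit nL hL) / nL).natAbs + 1))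
      ≤ L
  hπ3Y : isX = false → RcT + (N₃ + 1) * shearUnit nL hL ≤ L

end Skelφ

end Summit.CriticalPhenomena.PercolationContinuityZ3.Theorems.Transplant

end
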